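import Summits.BirchSwinnertonDyer.Rank1Residual.X5.TwoAdicTargetsB
import Summits.BirchSwinnertonDyer.Rank1Residual.X5.TwoAdicTargetsLead
import Summits.BirchSwinnertonDyer.Rank1Residual.X5.TwoAdicLocalIndex
import HarnessLib

/-!
# Class O1 (X5, `p = 2`, non-CM): `O1.KatoHTwoBoundAtTwo` — THESIS X of route L3-14 in the
# δ-LEDGER shape (item (20) of the o1 lead's typer queue v3.3; LEAD RULING PLAN C110 (b))

HONEST FRAMING (cell `b2b-bsdres`, run/shared/lean/b2b/bsd-rank1-residual/, verbatim in every
file): the goal of the cell is to DELETE the COMBINATION-SHAPED residual classes of the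
Birch–Swinnerton-Dyer formula for ALL analytic-rank `≤ 1` elliptic curves over `ℚ` — "full BSD
formula for every rank `≤ 1` curve in class `C`" assembled STRICTLY from published theorems — so
that the rank-`≤ 1` remainder becomes exactly the CONSTRUCTION-SHAPED classes, which are TYPED
(missing-input `Prop`s), NOT attempted. This is not "finishing BSD". Research routes; no claim
beyond stated classes; census output = EVIDENCE, never a Literature fact; nothing here is booked;
no mark of RESIDUAL-MAP §I moves.

Unit `b2b-bsdres-cc-typer-4` (lane CLASS-CLOSURE, class O1), gen 4. ONE typed research binder
(`@[conjecture]`, a family indexed by four ℕ-valued per-pair LEDGERS), one auxiliary ℕ, and the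
PROVED slack-one consumers. 0 named facts.

## The binder (lens-3 `cells/o1/ROUTES-O1.md` L3-14 G7.2 THESIS X l.1357, (D0)_Γ/(D1)_Γ v3 G8.2–G8.3;
## refuter v8 §35 J0–J3, v9; lead PLAN C110 (b) ruling, C112 (20))

THESIS X of L3-14 (Kato, Astérisque 295 §14 — Thm 14.5(3) → Lemma 14.15 → Prop 14.16 → local index —
transferred from "`p ≠ 2`, `f` potentially good at `p`, Fontaine–Laffaille" to "`p = 2`, any reduction
at `2`, Néron model", over the cyclotomic `ℤ₂`-TOWER `Γ`): for `E = W/ℚ` of analytic rank `0` with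
surjective `ρ_{E,2^∞}`,
  **`ord₂ #Ш(E)[2^∞] ≤ ord₂(L(E,1)/Ω_W) − ord₂ c₂(E) + ε_Γ(E) + δ_fin(E) + s_ℝ(E) + m(E)`**
with FOUR per-pair ℕ-valued LEDGERS, all explicit parameters here (LEAD RULING C110 (b): "ε_Γ AND
δ_fin (and s_ℝ) enter as explicit ℕ-valued per-pair DATA / parameters of the bound; NO global
hypothesis FS; 'FS' survives only as the NAME of the per-pair input δ_fin = 0; R-ε not typed"):
* `εΓ` — the (12.5.1)-exceptional crossing exponent of the Γ-tower descent: `2 / 1 / 0` according as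
  the semistabilising character of a potentially multiplicative `2` is `ψ₋₄ / ψ₋₈ /` other, `0` on
  potentially good and good rows ((D0)_Γ; three instruments agree 323/323, EVIDENCE);
* `δfin` — `log₂ #𝐇²_Γ(T₂E)[T]`, the finite-submodule ledger of (D1)_Γ v3 (`#M_Γ = |f_M(0)|₂⁻¹·#(M_fin)_Γ`;
  NOT instrument-measurable today; "FS" := the input `δfin = 0`);
* `sℝ` — the real-place term of the exact `2`-primary Poitou–Tate sequence (PLAN T4; `0` expected on
  `Δ < 0`);
* `m` — the period joint (D5): reading Kato's period as `Ω_W` (a Manin/lattice index, certified `0`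
  where Cremona's Manin-constant verification covers the class; the analogue of `hper₀`).
The μ-defect of the crux `K_ES(2)_Γ` (door Λ) is NOT a parameter: the binder asserts the bound Kato's
machine gives GIVEN the crux with defect `0` — that is its research content (AUDIT: Kato §§12–14 at
`p = 2` over `Λ_Γ = ℤ₂⟦T⟧`; the one printed `×2` is (14.9.3)/(14.12), absorbed in `sℝ`). Door F
(lens-2's (C1′) from R1 + `StubAtTwo` on `E(ℚ₂)[2] = 0` rows) discharges the same binder with
`εΓ ↦ δ_Cheb`, `δfin ↦ 0`.

SPELLING. `ord₂(L(E,1)/Ω_W) = ord₂ q + ord₂ ∏c − 2·ord₂ #E(ℚ)_tors` for the rational `q = shaAn W`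
(analytic rank `0`: `shaAn W = L(E,1)·#T²/(Ω_W·∏c)`, `Reg = 1`), so the display is stated in the
currency of `MissingUpperBoundAt` (`∃ q, shaAn W = q ∧ ord₂ #Ш ≤ ord₂ q + …`); `c₂` is
`localTamagawaAtTwo W` = the local Tamagawa number of `W/ℚ₂` (`localTamagawaNumber ℤ_[2]`, the `c₂` of
LEMMA ι's exponent `localLogIndexExponentAtTwo`, `X5/TwoAdicLocalIndex.lean`); `ord₂ #Ш` is
`padicValNat 2 W.shaOrder` (`= ord₂ #Ш[2^∞]` for finite `Ш`). At full `2`-adic image `#E(ℚ)_tors` is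
odd, so the torsion term vanishes; it is kept so that the display is literally `ord₂(L(E,1)/Ω_W)`.

* `localTamagawaAtTwo W : ℕ`; **`@[conjecture] KatoHTwoBoundAtTwo W εΓ δfin sℝ m : Prop`** — TYPED,
  research (the ONE binder of L3-14; door Λ = `K_ES(2)_Γ` + (D1) + LEMMA ι + T4, door F = R1 +
  `StubAtTwo`), NOT asserted; `katoHTwoBoundAtTwo_mono` (PROVED: monotone in the ledgers).
* `missingPPartAt_two_of_katoHTwo_of_slack_le_one`, **`bsdp_two_of_katoHTwo_of_slack_le_one`**
  (PROVED) — S6 of L3-14: the binder + `slack := (ord₂ ∏c − ord₂ c₂ − 2 ord₂ #T) + εΓ + δfin + sℝ + m ≤ 1`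
  + evenness of `ord₂ #Ш_an` (`ShaAnTwoAdicValEven`, T0) + Cassels–Tate + the certified lower half
  `MissingLowerBoundAt W 2` ⇒ `MissingPPartAt W 2` ⇒ `BSDp W 2` (the slack-one consumer G9,
  `missingPPartAt_two_of_lowerBound_of_slack_one`). Habitat census of record (EVIDENCE, at
  `δfin = 0` row by row): slack₀_Γ = 0 on 892, ≤ 1 on 1 660 of the 2 307 L3-14 classes.
References: [Kato2004Asterisque] Thm 12.5, 14.5, Lemma 14.15, Prop 14.16–14.18; [Miller2011LMS] Def.
1.1; [SilvermanAEC2009] X.4.14 (Cassels–Tate), IV.6.4/VII.2.1/C.15 (LEMMA ι inputs);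
[GreenbergLNM1716] Prop. 4.14/4.15 (nearest printed no-finite-submodule statement, another module).
-/

set_option autoImplicit false

noncomputable section

open scoped Classical

open WeierstrassCurve Literature.NumberTheory.EllipticCurves
  Literature.NumberTheory.EllipticCurves.Rank1Residual
  Literature.NumberTheory.EllipticCurves.Rank1Residual.Typed

namespace Summit.BirchSwinnertonDyer.Rank1Residual.X5.O1

variable (W : WeierstrassCurve ℚ) [W.IsElliptic] [W.IsGloballyMinimal]

/-! ## §1 The local Tamagawa number at `2` and the binder -/

omit [W.IsElliptic] [W.IsGloballyMinimal] in
/-- **`c₂(W)`, the local Tamagawa number of `W/ℚ₂`** (`[E(ℚ₂) : E₀(ℚ₂)]` on a `ℤ₂`-minimal model,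
`WeierstrassCurve.localTamagawaNumber ℤ_[2]` of `W.map (algebraMap ℚ ℚ_[2])`) — the `c₂` divided out
by LEMMA ι (`localLogIndexExponentAtTwo W = 1 + t₂ − ord₂ (localTamagawaAtTwo W) − ord₂ #Ẽ_ns(𝔽₂)`,
definitionally). [cite: SilvermanAEC2009, C.15–C.16 and VII.6] -/
def localTamagawaAtTwo : ℕ := (W.map (algebraMap ℚ ℚ_[2])).localTamagawaNumber ℤ_[2]

omit [W.IsElliptic] in
/-- `localTamagawaAtTwo` is the `c₂` of LEMMA ι's exponent (by `rfl`). [folklore] -/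
theorem localLogIndexExponentAtTwo_eq :
    localLogIndexExponentAtTwo W =
      1 + (padicValNat 2 (Nat.card
        (AddCommGroup.primaryComponent (W.map (algebraMap ℚ ℚ_[2])).toAffine.Point 2)) : ℤ)
      - (padicValNat 2 (localTamagawaAtTwo W) : ℤ) - (padicValNat 2 (reductionPointCount W 2) : ℤ) :=
  rfl

/-- **`O1.KatoHTwoBoundAtTwo W εΓ δfin sℝ m` — THESIS X of L3-14 in the δ-LEDGER shape (TYPED research
binder; `@[conjecture]`; NOT asserted).** For `W` of analytic rank `0` with surjective `ρ_{E,2^∞}`: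
`#Ш_an` is a rational `q` and
`ord₂ #Ш ≤ (ord₂ q + ord₂ ∏c − 2 ord₂ #E(ℚ)_tors) − ord₂ c₂ + εΓ + δfin + sℝ + m`, i.e.
`ord₂ #Ш[2^∞] ≤ ord₂(L(E,1)/Ω_W) − ord₂ c₂ + ε_Γ + δ_fin + s_ℝ + m` — what Kato's `𝐇²`-machine at `2`
(Thm 14.5(3) → Lemma 14.15 over `Λ_Γ = ℤ₂⟦T⟧` → Prop 14.16 with LEMMA ι as the local index and T4 at
the real place) delivers GIVEN the crux `K_ES(2)_Γ` with μ-defect `0` (door Λ), or lens-2's (C1′)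
GIVEN R1 + `StubAtTwo` on `E(ℚ₂)[2] = 0` rows (door F, `εΓ ↦ δ_Cheb`, `δfin ↦ 0`). The four ledgers
are per-pair ℕ DATA (lead ruling PLAN C110 (b)): `εΓ` ((D0)_Γ exceptional crossing, `2/1/0`), `δfin`
(`log₂ #𝐇²_Γ[T]`; "FS" names the input `0`), `sℝ` (real place, T4), `m` (period joint (D5)). Neither
door is a published theorem at `2`: AUDIT (Kato §§12–14 at `p = 2` over the Γ-tower; arXiv:1808.07726
is `p > 7`). [cite: Kato2004Asterisque, Thm. 14.5 (3), Lemma 14.15 and Prop. 14.16 (p ≠ 2 in print)]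
[cite: Miller2011LMS, Def. 1.1] -/
@[conjecture] def KatoHTwoBoundAtTwo (εΓ δfin sℝ m : ℕ) : Prop :=
  W.analyticRank = 0 → TwoAdicSurjective W →
    ∃ q : ℚ, shaAn W = (q : ℂ) ∧
      (padicValNat 2 W.shaOrder : ℤ) ≤
        (padicValRat 2 q + padicValNat 2 W.tamagawaProduct - 2 * padicValNat 2 W.torsionOrder)
          - padicValNat 2 (localTamagawaAtTwo W) + εΓ + δfin + sℝ + m

omit [W.IsElliptic] [W.IsGloballyMinimal] in
/-- The binder is monotone in its ledgers (bookkeeping). [cite: Miller2011LMS, Def. 1.1] -/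
theorem katoHTwoBoundAtTwo_mono {εΓ δfin sℝ m εΓ' δfin' sℝ' m' : ℕ} (h₁ : εΓ ≤ εΓ') (h₂ : δfin ≤ δfin')
    (h₃ : sℝ ≤ sℝ') (h₄ : m ≤ m') (h : KatoHTwoBoundAtTwo W εΓ δfin sℝ m) :
    KatoHTwoBoundAtTwo W εΓ' δfin' sℝ' m' := by
  intro hr him
  obtain ⟨q, hq, hle⟩ := h hr him
  refine ⟨q, hq, hle.trans ?_⟩
  have h₁' : (εΓ : ℤ) ≤ εΓ' := by exact_mod_cast h₁
  have h₂' : (δfin : ℤ) ≤ δfin' := by exact_mod_cast h₂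
  have h₃' : (sℝ : ℤ) ≤ sℝ' := by exact_mod_cast h₃
  have h₄' : (m : ℤ) ≤ m' := by exact_mod_cast h₄
  linarith

/-! ## §2 S6 — the slack-one consumers (PROVED) -/

omit [W.IsGloballyMinimal] in
/-- **S6 (PROVED): `MissingPPartAt W 2` from the binder at total slack `≤ 1`.** With
`slack := (ord₂ ∏c − ord₂ c₂ − 2 ord₂ #T) + εΓ + δfin + sℝ + m ≤ 1` (on the habitat: `Σ_{ℓ odd} ord₂ c_ℓ`
plus the ledgers), the binder gives `ord₂ #Ш ≤ ord₂ #Ш_an + 1`; `ord₂ #Ш_an` even (T0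
`ShaAnTwoAdicValEven`, non-CM, analytic rank `≤ 1`), `#Ш` a square (Cassels–Tate `hCT`) and the
certified lower half close the pair (`missingPPartAt_two_of_lowerBound_of_slack_one`).
[cite: Miller2011LMS, Def. 1.1] [cite: SilvermanAEC2009, Thm. X.4.14 (Cassels–Tate ⇒ #Ш square)] -/
theorem missingPPartAt_two_of_katoHTwo_of_slack_le_one (hCT : exists_casselsTate_pairing (K := ℚ))
    [Finite W.sha] {εΓ δfin sℝ m : ℕ} (hX : KatoHTwoBoundAtTwo W εΓ δfin sℝ m)
    (hcm : ¬ W.HasCM) (hr : W.analyticRank = 0) (him : TwoAdicSurjective W)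
    (heven : ShaAnTwoAdicValEven W) (hlow : MissingLowerBoundAt W 2)
    (hslack : (padicValNat 2 W.tamagawaProduct : ℤ) - padicValNat 2 (localTamagawaAtTwo W)
      - 2 * padicValNat 2 W.torsionOrder + εΓ + δfin + sℝ + m ≤ 1) : MissingPPartAt W 2 := by
  obtain ⟨q, hq, hup⟩ := hX hr him
  have hev : Even (padicValRat 2 q) := by
    obtain ⟨q', hq', -, hev'⟩ := heven (by rw [hr]; exact zero_le_one) hcm
    have hqq : q' = q := by exact_mod_cast hq'.symm.trans hq
    subst hqq
    exact hev'
  refine missingPPartAt_two_of_lowerBound_of_slack_one W hCT hlow ⟨q, hq, hev, ?_⟩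
  linarith

omit [W.IsGloballyMinimal] in
/-- **S6 END-STATE per pair (PROVED): `BSD(E,2)` from the binder at total slack `≤ 1`**, analytic rank
`0`, full `2`-adic image, non-CM: `KatoHTwoBoundAtTwo W εΓ δfin sℝ m` (research, the ONE binder) +
the per-pair DATA {`εΓ`, `δfin`, `sℝ`, `m`, slack `≤ 1`} + T0 (`ShaAnTwoAdicValEven`) + Cassels–Tate +
GZK + the certified lower half `hlow` ⇒ `BSDp W 2`. Nothing is booked; on the L3-14 habitat the slack
census of record reads `≤ 1` on 1 660 of 2 307 classes AT `δfin = sℝ = m = 0` (EVIDENCE).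
[cite: Miller2011LMS, Def. 1.1 and §1] [cite: SilvermanAEC2009, Thm. X.4.14] -/
theorem bsdp_two_of_katoHTwo_of_slack_le_one (hCT : exists_casselsTate_pairing (K := ℚ))
    (hGZK : rank_eq_analyticRank_of_analyticRank_le_one) {εΓ δfin sℝ m : ℕ}
    (hX : KatoHTwoBoundAtTwo W εΓ δfin sℝ m) (hcm : ¬ W.HasCM) (hr : W.analyticRank = 0)
    (him : TwoAdicSurjective W) (heven : ShaAnTwoAdicValEven W) (hlow : MissingLowerBoundAt W 2)
    (hslack : (padicValNat 2 W.tamagawaProduct : ℤ) - padicValNat 2 (localTamagawaAtTwo W)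
      - 2 * padicValNat 2 W.torsionOrder + εΓ + δfin + sℝ + m ≤ 1) : BSDp W 2 := by
  haveI : Finite W.sha := (hGZK W (by rw [hr]; exact zero_le_one)).2
  exact bsdp_of_missingPPartAt W 2 hGZK (by rw [hr]; exact zero_le_one)
    (missingPPartAt_two_of_katoHTwo_of_slack_le_one W hCT hX hcm hr him heven hlow hslack)

end Summit.BirchSwinnertonDyer.Rank1Residual.X5.O1

end
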